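import Mathlib
import Literature.RepresentationTheory.HeisenbergGroup.StoneVonNeumannDensity
import HarnessLib

/-!
# Tensor products of total families are total in `L²` of a product measure

Topic `MeasureTheory/Integral`; namespace `Literature.MeasureTheory.Integral`.  KERNEL ONLY: theorems; no definition,
no named fact, no `sorry`.

For σ-finite `μ` on `X`, `ν` on `Y` and square-integrable `f : X → ℂ`, `g : Y → ℂ`, the TENSOR `(f ⊗ g)(x, y) = f x · g y`
is square-integrable for `μ ⊗ ν` with `‖f ⊗ g‖₂ = ‖f‖₂ ‖g‖₂` (Tonelli), and the density statement behind
`L²(μ) ⊗̂ L²(ν) = L²(μ ⊗ ν)` [ReedSimonI1980, Thm II.10] holds: if families `a i ∈ L²(μ)`, `b k ∈ L²(ν)` each span a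
DENSE subspace, the tensors `a i ⊗ b k` span a dense subspace of `L²(μ ⊗ ν)` (**`dense_span_tensor`**).  No
separability and no Hilbert tensor product are used: a vector orthogonal to all `a i ⊗ b k` is orthogonal to every
`f ⊗ g` (bounded bilinearity, §1–§2), in particular to the indicator of every rectangle with finite-measure sides; by
Dynkin's π-λ theorem inside each rectangle of an exhausting sequence and `L²`-continuity along monotone unions (§3) it is
orthogonal to the indicator of every finite-measure measurable set, hence to everything (`Lp.induction`, §4:
**`eq_zero_of_inner_tensor_eq_zero`**).  Use (tree): cyclicity of product vectors in `L²` of the adèles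
`= L²` of (archimedean part × finite part) for the adelic Heisenberg representation [GelbartRogawski1991, §3.1 p. 454
L19–21], from the cyclicity of each factor.

## References
* [ReedSimonI1980] M. Reed, B. Simon, *Methods of Modern Mathematical Physics I: Functional Analysis* (1980), §II.4,
  Theorem II.10 (the span of the `f ⊗ g` is dense in `L²(M₁ × M₂)`).
* [GelbartRogawski1991] S. Gelbart, J. Rogawski, Invent. Math. 105 (1991), §3.1 p. 454 L19–21.
-/

set_option autoImplicit false

noncomputable section

open _root_.MeasureTheory _root_.MeasureTheory.Measure Set Filter Function
open scoped ENNReal Topology InnerProductSpace symmDiff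
open Literature.RepresentationTheory.HeisenbergGroup.SchrodingerIrreducible (punion punion_subset subset_punion
  iUnion_punion monotone_punion measurableSet_punion disjoint_punion indicatorConstLp_set_congr indicatorConstLp_eq_smul_one)

namespace Literature.MeasureTheory.Integral

/-- the rectangles `S_n ×ˢ T_n` built from exhausting sequences exhaust `X × Y` (for monotone `S`, `T`). [folklore] -/
private theorem iUnion_prod_of_monotone {X Y : Type*} {S : ℕ → Set X} {T : ℕ → Set Y} (hS : Monotone S) (hT : Monotone T)
    (hSU : ⋃ n, S n = Set.univ) (hTU : ⋃ n, T n = Set.univ) : ⋃ n, S n ×ˢ T n = Set.univ := by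
  refine Set.eq_univ_of_forall fun z => ?_
  obtain ⟨i, hi⟩ : ∃ i, z.1 ∈ S i := Set.mem_iUnion.1 (hSU ▸ Set.mem_univ z.1)
  obtain ⟨j, hj⟩ : ∃ j, z.2 ∈ T j := Set.mem_iUnion.1 (hTU ▸ Set.mem_univ z.2)
  exact Set.mem_iUnion.2 ⟨max i j, hS (le_max_left i j) hi, hT (le_max_right i j) hj⟩

variable {X Y : Type*} [MeasurableSpace X] [MeasurableSpace Y] (μ : Measure X) (ν : Measure Y) [SigmaFinite ν]

/-! ## §1 The tensor `f ⊗ g` of two square-integrable functions -/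

section Tensor

/-- **Tonelli for the `L²` norm of a tensor**: `‖f ⊗ g‖₂ = ‖f‖₂ ‖g‖₂` (as extended reals).
[cite: ReedSimonI1980, §II.4 Theorem II.10] -/
theorem eLpNorm_tensor {f : X → ℂ} {g : Y → ℂ} (hf : AEStronglyMeasurable f μ) (hg : AEStronglyMeasurable g ν) :
    eLpNorm (fun z : X × Y => f z.1 * g z.2) 2 (μ.prod ν) = eLpNorm f 2 μ * eLpNorm g 2 ν := by
  have h2 : (2 : ℝ≥0∞) ≠ 0 := two_ne_zero
  have h2' : (2 : ℝ≥0∞) ≠ ∞ := ENNReal.ofNat_ne_top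
  rw [eLpNorm_eq_lintegral_rpow_enorm_toReal h2 h2', eLpNorm_eq_lintegral_rpow_enorm_toReal h2 h2',
    eLpNorm_eq_lintegral_rpow_enorm_toReal h2 h2']
  simp only [ENNReal.toReal_ofNat, enorm_mul, ENNReal.mul_rpow_of_nonneg _ _ (zero_le_two (α := ℝ))]
  rw [lintegral_prod_mul (hf.enorm.pow_const _) (hg.enorm.pow_const _),
    ENNReal.mul_rpow_of_nonneg _ _ (by positivity)]

omit [SigmaFinite ν] in
/-- `f ⊗ g` is a.e. strongly measurable for `μ ⊗ ν`. [cite: ReedSimonI1980, §II.4 Theorem II.10] -/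
theorem aestronglyMeasurable_tensor {f : X → ℂ} {g : Y → ℂ} (hf : AEStronglyMeasurable f μ)
    (hg : AEStronglyMeasurable g ν) : AEStronglyMeasurable (fun z : X × Y => f z.1 * g z.2) (μ.prod ν) :=
  (hf.comp_quasiMeasurePreserving quasiMeasurePreserving_fst).mul
    (hg.comp_quasiMeasurePreserving quasiMeasurePreserving_snd)

/-- **`f ⊗ g ∈ L²(μ ⊗ ν)`** for `f ∈ L²(μ)`, `g ∈ L²(ν)`. [cite: ReedSimonI1980, §II.4 Theorem II.10] -/
theorem memLp_tensor {f : X → ℂ} {g : Y → ℂ} (hf : MemLp f 2 μ) (hg : MemLp g 2 ν) :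
    MemLp (fun z : X × Y => f z.1 * g z.2) 2 (μ.prod ν) :=
  ⟨aestronglyMeasurable_tensor μ ν hf.1 hg.1, by
    rw [eLpNorm_tensor μ ν hf.1 hg.1]
    exact ENNReal.mul_lt_top hf.2 hg.2⟩

/-- `f ⊗ g ∈ L²(μ ⊗ ν)` for `Lp` classes `f`, `g`. [cite: ReedSimonI1980, §II.4 Theorem II.10] -/
theorem memLp_tensor_Lp (f : Lp ℂ 2 μ) (g : Lp ℂ 2 ν) :
    MemLp (fun z : X × Y => f z.1 * g z.2) 2 (μ.prod ν) :=
  memLp_tensor μ ν (Lp.memLp f) (Lp.memLp g)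

/-- **`‖f ⊗ g‖ = ‖f‖ ‖g‖`** in `L²(μ ⊗ ν)`. [cite: ReedSimonI1980, §II.4 Theorem II.10] -/
theorem norm_toLp_tensor (f : Lp ℂ 2 μ) (g : Lp ℂ 2 ν) :
    ‖(memLp_tensor_Lp μ ν f g).toLp _‖ = ‖f‖ * ‖g‖ := by
  rw [Lp.norm_toLp, eLpNorm_tensor μ ν (Lp.aestronglyMeasurable f) (Lp.aestronglyMeasurable g),
    ENNReal.toReal_mul, Lp.norm_def, Lp.norm_def]

omit [SigmaFinite ν] in
/-- a.e. equalities on the factors transport to the tensor. [cite: ReedSimonI1980, §II.4 Theorem II.10] -/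
theorem tensor_congr_ae {f f' : X → ℂ} {g g' : Y → ℂ} (hf : f =ᵐ[μ] f') (hg : g =ᵐ[ν] g') :
    (fun z : X × Y => f z.1 * g z.2) =ᵐ[μ.prod ν] fun z => f' z.1 * g' z.2 := by
  filter_upwards [(quasiMeasurePreserving_fst (μ := μ) (ν := ν)).ae_eq_comp hf,
    (quasiMeasurePreserving_snd (μ := μ) (ν := ν)).ae_eq_comp hg] with z h1 h2
  simp only [Function.comp_apply] at h1 h2
  rw [h1, h2]

/-- additivity in the first factor (as `L²` classes). [cite: ReedSimonI1980, §II.4 Theorem II.10] -/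
theorem toLp_tensor_add_left (f f' : Lp ℂ 2 μ) (g : Lp ℂ 2 ν) :
    (memLp_tensor_Lp μ ν (f + f') g).toLp _ =
      (memLp_tensor_Lp μ ν f g).toLp _ + (memLp_tensor_Lp μ ν f' g).toLp _ := by
  rw [← MemLp.toLp_add]
  refine MemLp.toLp_congr _ _ ?_
  filter_upwards [tensor_congr_ae μ ν (Lp.coeFn_add f f') (ae_eq_refl (g : Y → ℂ))] with z hz
  rw [hz, Pi.add_apply, Pi.add_apply, add_mul]

/-- homogeneity in the first factor. [cite: ReedSimonI1980, §II.4 Theorem II.10] -/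
theorem toLp_tensor_smul_left (c : ℂ) (f : Lp ℂ 2 μ) (g : Lp ℂ 2 ν) :
    (memLp_tensor_Lp μ ν (c • f) g).toLp _ = c • (memLp_tensor_Lp μ ν f g).toLp _ := by
  rw [← MemLp.toLp_const_smul]
  refine MemLp.toLp_congr _ _ ?_
  filter_upwards [tensor_congr_ae μ ν (Lp.coeFn_smul c f) (ae_eq_refl (g : Y → ℂ))] with z hz
  rw [hz, Pi.smul_apply, Pi.smul_apply, smul_eq_mul, smul_eq_mul, mul_assoc]

/-- additivity in the second factor. [cite: ReedSimonI1980, §II.4 Theorem II.10] -/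
theorem toLp_tensor_add_right (f : Lp ℂ 2 μ) (g g' : Lp ℂ 2 ν) :
    (memLp_tensor_Lp μ ν f (g + g')).toLp _ =
      (memLp_tensor_Lp μ ν f g).toLp _ + (memLp_tensor_Lp μ ν f g').toLp _ := by
  rw [← MemLp.toLp_add]
  refine MemLp.toLp_congr _ _ ?_
  filter_upwards [tensor_congr_ae μ ν (ae_eq_refl (f : X → ℂ)) (Lp.coeFn_add g g')] with z hz
  rw [hz, Pi.add_apply, Pi.add_apply, mul_add]

/-- homogeneity in the second factor. [cite: ReedSimonI1980, §II.4 Theorem II.10] -/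
theorem toLp_tensor_smul_right (c : ℂ) (f : Lp ℂ 2 μ) (g : Lp ℂ 2 ν) :
    (memLp_tensor_Lp μ ν f (c • g)).toLp _ = c • (memLp_tensor_Lp μ ν f g).toLp _ := by
  rw [← MemLp.toLp_const_smul]
  refine MemLp.toLp_congr _ _ ?_
  filter_upwards [tensor_congr_ae μ ν (ae_eq_refl (f : X → ℂ)) (Lp.coeFn_smul c g)] with z hz
  rw [hz, Pi.smul_apply, Pi.smul_apply, smul_eq_mul, smul_eq_mul, mul_left_comm]

/-- `f ↦ f ⊗ g` is a bounded linear map `L²(μ) → L²(μ ⊗ ν)` (stated as an existence, no definition).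
[cite: ReedSimonI1980, §II.4 Theorem II.10] -/
theorem exists_clm_tensor_left (g : Lp ℂ 2 ν) :
    ∃ T : Lp ℂ 2 μ →L[ℂ] Lp ℂ 2 (μ.prod ν), ∀ f, T f = (memLp_tensor_Lp μ ν f g).toLp _ := by
  let L : Lp ℂ 2 μ →ₗ[ℂ] Lp ℂ 2 (μ.prod ν) :=
    { toFun := fun f => (memLp_tensor_Lp μ ν f g).toLp _
      map_add' := fun f f' => toLp_tensor_add_left μ ν f f' g
      map_smul' := fun c f => toLp_tensor_smul_left μ ν c f g }
  refine ⟨L.mkContinuous ‖g‖ fun f => ?_, fun f => rfl⟩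
  change ‖(memLp_tensor_Lp μ ν f g).toLp _‖ ≤ ‖g‖ * ‖f‖
  rw [norm_toLp_tensor, mul_comm]

/-- `g ↦ f ⊗ g` is a bounded linear map `L²(ν) → L²(μ ⊗ ν)` (stated as an existence, no definition).
[cite: ReedSimonI1980, §II.4 Theorem II.10] -/
theorem exists_clm_tensor_right (f : Lp ℂ 2 μ) :
    ∃ T : Lp ℂ 2 ν →L[ℂ] Lp ℂ 2 (μ.prod ν), ∀ g, T g = (memLp_tensor_Lp μ ν f g).toLp _ := by
  let L : Lp ℂ 2 ν →ₗ[ℂ] Lp ℂ 2 (μ.prod ν) :=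
    { toFun := fun g => (memLp_tensor_Lp μ ν f g).toLp _
      map_add' := fun g g' => toLp_tensor_add_right μ ν f g g'
      map_smul' := fun c g => toLp_tensor_smul_right μ ν c f g }
  refine ⟨L.mkContinuous ‖f‖ fun g => ?_, fun g => rfl⟩
  change ‖(memLp_tensor_Lp μ ν f g).toLp _‖ ≤ ‖f‖ * ‖g‖
  rw [norm_toLp_tensor]

end Tensor

/-! ## §2 Orthogonality to the tensors of two total families -/

/-- a continuous linear functional vanishing on a family with dense span vanishes. [folklore] -/
private theorem clm_apply_eq_zero_of_dense_span {E : Type*} [NormedAddCommGroup E] [InnerProductSpace ℂ E] {σ : Type*}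
    (e : σ → E) (he : Dense (Submodule.span ℂ (Set.range e) : Set E)) (φ : E →L[ℂ] ℂ) (hφ : ∀ i, φ (e i) = 0)
    (u : E) : φ u = 0 := by
  have hle : Submodule.span ℂ (Set.range e) ≤ LinearMap.ker (φ : E →ₗ[ℂ] ℂ) :=
    Submodule.span_le.2 (Set.range_subset_iff.2 fun i => hφ i)
  have hcl : (Submodule.span ℂ (Set.range e)).topologicalClosure ≤ LinearMap.ker (φ : E →ₗ[ℂ] ℂ) := by
    rw [← φ.isClosed_ker.submodule_topologicalClosure_eq]
    exact Submodule.topologicalClosure_mono hle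
  rw [Submodule.dense_iff_topologicalClosure_eq_top] at he
  rw [he] at hcl
  exact hcl Submodule.mem_top

/-- **a vector orthogonal to the tensors `a i ⊗ b k` of two families with dense spans is orthogonal to every tensor
`f ⊗ g`** (the functional `f ↦ ⟪F, f ⊗ b k⟫` is continuous and kills the `a i`; then the same in `g`).
[cite: ReedSimonI1980, §II.4 Theorem II.10] -/
theorem inner_tensor_eq_zero_of_dense {ι κ : Type*} (a : ι → Lp ℂ 2 μ) (b : κ → Lp ℂ 2 ν)
    (ha : Dense (Submodule.span ℂ (Set.range a) : Set (Lp ℂ 2 μ)))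
    (hb : Dense (Submodule.span ℂ (Set.range b) : Set (Lp ℂ 2 ν))) (F : Lp ℂ 2 (μ.prod ν))
    (hF : ∀ i k, ⟪F, (memLp_tensor_Lp μ ν (a i) (b k)).toLp _⟫_ℂ = 0) (f : Lp ℂ 2 μ) (g : Lp ℂ 2 ν) :
    ⟪F, (memLp_tensor_Lp μ ν f g).toLp _⟫_ℂ = 0 := by
  -- first: every `f`, against each `b k`
  have h1 : ∀ (k : κ) (f : Lp ℂ 2 μ), ⟪F, (memLp_tensor_Lp μ ν f (b k)).toLp _⟫_ℂ = 0 := by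
    intro k f
    obtain ⟨T, hT⟩ := exists_clm_tensor_left μ ν (b k)
    have h := clm_apply_eq_zero_of_dense_span a ha ((innerSL ℂ F).comp T) (fun i => by
      change ⟪F, T (a i)⟫_ℂ = 0
      rw [hT, hF]) f
    change ⟪F, T f⟫_ℂ = 0 at h
    rwa [hT] at h
  -- then: every `g`
  obtain ⟨T, hT⟩ := exists_clm_tensor_right μ ν f
  have h := clm_apply_eq_zero_of_dense_span b hb ((innerSL ℂ F).comp T) (fun k => by
    change ⟪F, T (b k)⟫_ℂ = 0
    rw [hT, h1]) g
  change ⟪F, T g⟫_ℂ = 0 at h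
  rwa [hT] at h

/-! ## §3 Rectangles, Dynkin's π-λ theorem, and `L²`-continuity along monotone unions -/

/-- **`1_A ⊗ 1_B = 1_{A ×ˢ B}`** as `L²(μ ⊗ ν)` classes. [cite: ReedSimonI1980, §II.4 Theorem II.10] -/
theorem toLp_tensor_indicatorConstLp {A : Set X} {B : Set Y} (hA : MeasurableSet A) (hB : MeasurableSet B)
    (hμA : μ A ≠ ∞) (hνB : ν B ≠ ∞) (hAB : (μ.prod ν) (A ×ˢ B) ≠ ∞) :
    (memLp_tensor_Lp μ ν (indicatorConstLp 2 hA hμA (1 : ℂ)) (indicatorConstLp 2 hB hνB (1 : ℂ))).toLp _ =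
      indicatorConstLp 2 (hA.prod hB) hAB (1 : ℂ) := by
  apply Lp.ext
  filter_upwards [MemLp.coeFn_toLp (memLp_tensor_Lp μ ν (indicatorConstLp 2 hA hμA (1 : ℂ))
      (indicatorConstLp 2 hB hνB (1 : ℂ))),
    indicatorConstLp_coeFn (p := 2) (hs := hA.prod hB) (hμs := hAB) (c := (1 : ℂ)),
    tensor_congr_ae μ ν (indicatorConstLp_coeFn (p := 2) (hs := hA) (hμs := hμA) (c := (1 : ℂ)))
      (indicatorConstLp_coeFn (p := 2) (hs := hB) (hμs := hνB) (c := (1 : ℂ)))] with z h1 h2 h3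
  rw [h1, h3, h2]
  classical
  simp only [Set.indicator_apply, Set.mem_prod]
  split_ifs <;> simp_all

/-- `L²`-continuity along the partial unions of a disjoint sequence with union of finite measure:
`1_{f 0 ∪ … ∪ f n} → 1_{⋃ f i}`. [folklore] -/
private theorem tendsto_indicatorConstLp_punion {Z : Type*} [MeasurableSpace Z] (ρ : Measure Z) (f : ℕ → Set Z)
    (hfm : ∀ i, MeasurableSet (f i)) (hfin : ρ (⋃ i, f i) ≠ ∞) :
    Tendsto (fun n => indicatorConstLp 2 (measurableSet_punion hfm n)
      ((measure_mono (punion_subset f n)).trans_lt hfin.lt_top).ne (1 : ℂ)) atTop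
      (𝓝 (indicatorConstLp 2 (MeasurableSet.iUnion hfm) hfin (1 : ℂ))) := by
  refine tendsto_indicatorConstLp_set (by norm_num) ?_
  have hanti : Antitone fun n => (⋃ i, f i) \ punion f n :=
    fun n m hnm => Set.sdiff_subset_sdiff_right (monotone_punion f hnm)
  have hlim := tendsto_measure_iInter_atTop (μ := ρ)
    (fun n => ((MeasurableSet.iUnion hfm).diff (measurableSet_punion hfm n)).nullMeasurableSet) hanti
    ⟨0, ((measure_mono Set.sdiff_subset).trans_lt hfin.lt_top).ne⟩
  have hempty : ⋂ n, (⋃ i, f i) \ punion f n = ∅ := by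
    rw [← Set.sdiff_iUnion, iUnion_punion, Set.sdiff_self]
  rw [hempty, measure_empty] at hlim
  refine hlim.congr fun n => ?_
  simp only [Function.comp_apply]
  rw [symmDiff_of_le (punion_subset f n)]

/-- `L²`-continuity along an increasing sequence exhausting a finite-measure set: `1_{s ∩ R n} → 1_s` when `R n ↑`
and `s ⊆ ⋃ R n`. [folklore] -/
private theorem tendsto_indicatorConstLp_inter_of_monotone {Z : Type*} [MeasurableSpace Z] (ρ : Measure Z) {s : Set Z}
    (hs : MeasurableSet s) (hρs : ρ s ≠ ∞) (R : ℕ → Set Z) (hRm : ∀ n, MeasurableSet (R n)) (hRmono : Monotone R)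
    (hsR : s ⊆ ⋃ n, R n) :
    Tendsto (fun n => indicatorConstLp 2 (hs.inter (hRm n))
      ((measure_mono Set.inter_subset_left).trans_lt hρs.lt_top).ne (1 : ℂ)) atTop
      (𝓝 (indicatorConstLp 2 hs hρs (1 : ℂ))) := by
  refine tendsto_indicatorConstLp_set (by norm_num) ?_
  have hmono : Monotone fun n => s ∩ R n := fun n m hnm => Set.inter_subset_inter_right _ (hRmono hnm)
  have hU : ⋃ n, s ∩ R n = s := by rw [← Set.inter_iUnion, Set.inter_eq_left.2 hsR]
  have hlim : Tendsto (fun n => ρ (s ∩ R n)) atTop (𝓝 (ρ s)) := by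
    have h := tendsto_measure_iUnion_atTop (μ := ρ) hmono
    rwa [hU] at h
  have hsub : Tendsto (fun n => ρ s - ρ (s ∩ R n)) atTop (𝓝 (ρ s - ρ s)) :=
    ENNReal.Tendsto.sub tendsto_const_nhds hlim (Or.inl hρs)
  rw [tsub_self] at hsub
  refine hsub.congr fun n => ?_
  rw [symmDiff_of_le Set.inter_subset_left, measure_sdiff Set.inter_subset_left (hs.inter (hRm n)).nullMeasurableSet
    ((measure_mono Set.inter_subset_left).trans_lt hρs.lt_top).ne]

/-- **Dynkin's π-λ step**: if `F ∈ L²(μ ⊗ ν)` is orthogonal to the indicator of every rectangle with finite-measure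
sides, it is orthogonal to the indicator of `s ∩ (S ×ˢ T)` for every measurable `s` and every such rectangle `S ×ˢ T`
(the measurable `s` with this property form a Dynkin system containing the π-system of rectangles).
[cite: ReedSimonI1980, §II.4 Theorem II.10] -/
theorem inner_indicatorConstLp_inter_eq_zero_of_rectangles (F : Lp ℂ 2 (μ.prod ν))
    (hF : ∀ (A : Set X) (B : Set Y) (hA : MeasurableSet A) (hB : MeasurableSet B) (hμA : μ A ≠ ∞) (hνB : ν B ≠ ∞)
      (hAB : (μ.prod ν) (A ×ˢ B) ≠ ∞), ⟪F, indicatorConstLp 2 (hA.prod hB) hAB (1 : ℂ)⟫_ℂ = 0)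
    {S : Set X} {T : Set Y} (hS : MeasurableSet S) (hT : MeasurableSet T) (hμS : μ S ≠ ∞) (hνT : ν T ≠ ∞)
    (s : Set (X × Y)) (hs : MeasurableSet s) (hfin : (μ.prod ν) (s ∩ S ×ˢ T) ≠ ∞) :
    ⟪F, indicatorConstLp 2 (hs.inter (hS.prod hT)) hfin (1 : ℂ)⟫_ℂ = 0 := by
  have hST : (μ.prod ν) (S ×ˢ T) ≠ ∞ := by
    rw [Measure.prod_prod]; exact ENNReal.mul_ne_top hμS hνT
  -- every subset of the rectangle has finite measure
  have hfin' : ∀ {t : Set (X × Y)}, t ⊆ S ×ˢ T → (μ.prod ν) t ≠ ∞ := fun ht =>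
    ((measure_mono ht).trans_lt hST.lt_top).ne
  revert hfin
  induction s, hs using MeasurableSpace.induction_on_inter generateFrom_prod.symm isPiSystem_prod with
  | empty =>
    intro hfin
    rw [indicatorConstLp_set_congr (μ.prod ν) _ _ MeasurableSet.empty (by simp) (Set.empty_inter _) 1,
      indicatorConstLp_empty, inner_zero_right]
  | basic t ht =>
    intro hfin
    obtain ⟨A, hA, B, hB, rfl⟩ := ht
    have hAS : μ (A ∩ S) ≠ ∞ := ((measure_mono Set.inter_subset_right).trans_lt hμS.lt_top).ne
    have hBT : ν (B ∩ T) ≠ ∞ := ((measure_mono Set.inter_subset_right).trans_lt hνT.lt_top).ne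
    have hprod : (μ.prod ν) ((A ∩ S) ×ˢ (B ∩ T)) ≠ ∞ := by
      rw [← Set.prod_inter_prod]; exact hfin
    rw [indicatorConstLp_set_congr (μ.prod ν) _ _ ((hA.inter hS).prod (hB.inter hT)) hprod Set.prod_inter_prod 1]
    exact hF _ _ (hA.inter hS) (hB.inter hT) hAS hBT hprod
  | compl t htm ih =>
    intro hfin
    -- `1_{tᶜ ∩ R} = 1_R - 1_{t ∩ R}`
    have hdisj : Disjoint (t ∩ S ×ˢ T) (tᶜ ∩ S ×ˢ T) :=
      Set.disjoint_of_subset_left Set.inter_subset_left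
        (Set.disjoint_of_subset_right Set.inter_subset_left disjoint_compl_right)
    have hunion : t ∩ S ×ˢ T ∪ tᶜ ∩ S ×ˢ T = S ×ˢ T := by
      rw [← Set.union_inter_distrib_right, Set.union_compl_self, Set.univ_inter]
    have hsum := indicatorConstLp_disjoint_union (p := 2) (htm.inter (hS.prod hT)) (htm.compl.inter (hS.prod hT))
      (hfin' Set.inter_subset_right) hfin hdisj (1 : ℂ)
    rw [indicatorConstLp_set_congr (μ.prod ν) _ _ (hS.prod hT) hST hunion 1] at hsum
    have hR : ⟪F, indicatorConstLp 2 (hS.prod hT) hST (1 : ℂ)⟫_ℂ = 0 := by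
      have h := hF S T hS hT hμS hνT hST
      exact h
    rw [hsum, inner_add_right, ih (hfin' Set.inter_subset_right)] at hR
    simpa using hR
  | iUnion f hdisj hfm ih =>
    intro hfin
    -- `1_{(⋃ f i) ∩ R}` is the `L²`-limit of the indicators of the disjoint partial unions
    have hfm' : ∀ i, MeasurableSet (f i ∩ S ×ˢ T) := fun i => (hfm i).inter (hS.prod hT)
    have hdisj' : Pairwise (Disjoint on fun i => f i ∩ S ×ˢ T) := fun i j hij =>
      Set.disjoint_of_subset Set.inter_subset_left Set.inter_subset_left (hdisj hij)
    have hU : (⋃ i, f i) ∩ S ×ˢ T = ⋃ i, f i ∩ S ×ˢ T := Set.iUnion_inter _ _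
    have hfinU : (μ.prod ν) (⋃ i, f i ∩ S ×ˢ T) ≠ ∞ := hfin' (Set.iUnion_subset fun i => Set.inter_subset_right)
    have hstep : ∀ n, ⟪F, indicatorConstLp 2 (measurableSet_punion hfm' n)
        ((measure_mono (punion_subset _ n)).trans_lt hfinU.lt_top).ne (1 : ℂ)⟫_ℂ = 0 := by
      intro n
      induction n with
      | zero => exact ih 0 (hfin' Set.inter_subset_right)
      | succ n ihn =>
        have h' : indicatorConstLp 2 (measurableSet_punion hfm' (n + 1))
            ((measure_mono (punion_subset _ (n + 1))).trans_lt hfinU.lt_top).ne (1 : ℂ) =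
            indicatorConstLp 2 (measurableSet_punion hfm' n) ((measure_mono (punion_subset _ n)).trans_lt hfinU.lt_top).ne
              (1 : ℂ) + indicatorConstLp 2 (hfm' (n + 1)) (hfin' Set.inter_subset_right) (1 : ℂ) :=
          indicatorConstLp_disjoint_union (measurableSet_punion hfm' n) (hfm' (n + 1)) _ _
            (disjoint_punion hdisj' n (n + 1) (Nat.lt_succ_self n)) (1 : ℂ)
        rw [h', inner_add_right, ihn, ih (n + 1) (hfin' Set.inter_subset_right), add_zero]
    have htend := tendsto_indicatorConstLp_punion (μ.prod ν) (fun i => f i ∩ S ×ˢ T) hfm' hfinU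
    have hlim := ((tendsto_const_nhds (x := F)).inner htend).congr hstep
    have h0 : ⟪F, indicatorConstLp 2 (MeasurableSet.iUnion hfm') hfinU (1 : ℂ)⟫_ℂ = 0 :=
      tendsto_nhds_unique hlim tendsto_const_nhds
    rw [indicatorConstLp_set_congr (μ.prod ν) _ _ ((MeasurableSet.iUnion hfm).inter (hS.prod hT)) hfin hU.symm 1]
      at h0
    exact h0

/-! ## §4 The density theorem -/

variable [SigmaFinite μ]

/-- **a vector of `L²(μ ⊗ ν)` orthogonal to every tensor `a i ⊗ b k` of two families with dense spans is zero**
(`μ`, `ν` σ-finite). [cite: ReedSimonI1980, §II.4 Theorem II.10] -/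
theorem eq_zero_of_inner_tensor_eq_zero {ι κ : Type*} (a : ι → Lp ℂ 2 μ) (b : κ → Lp ℂ 2 ν)
    (ha : Dense (Submodule.span ℂ (Set.range a) : Set (Lp ℂ 2 μ)))
    (hb : Dense (Submodule.span ℂ (Set.range b) : Set (Lp ℂ 2 ν))) (F : Lp ℂ 2 (μ.prod ν))
    (hF : ∀ i k, ⟪F, (memLp_tensor_Lp μ ν (a i) (b k)).toLp _⟫_ℂ = 0) : F = 0 := by
  -- (1) orthogonal to the indicators of rectangles with finite-measure sides
  have hrect : ∀ (A : Set X) (B : Set Y) (hA : MeasurableSet A) (hB : MeasurableSet B) (hμA : μ A ≠ ∞)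
      (hνB : ν B ≠ ∞) (hAB : (μ.prod ν) (A ×ˢ B) ≠ ∞), ⟪F, indicatorConstLp 2 (hA.prod hB) hAB (1 : ℂ)⟫_ℂ = 0 := by
    intro A B hA hB hμA hνB hAB
    rw [← toLp_tensor_indicatorConstLp μ ν hA hB hμA hνB hAB]
    exact inner_tensor_eq_zero_of_dense μ ν a b ha hb F hF _ _
  -- (2) orthogonal to the indicator of every finite-measure measurable set
  have hind : ∀ (s : Set (X × Y)) (hs : MeasurableSet s) (hρs : (μ.prod ν) s ≠ ∞),
      ⟪F, indicatorConstLp 2 hs hρs (1 : ℂ)⟫_ℂ = 0 := by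
    intro s hs hρs
    set R : ℕ → Set (X × Y) := fun n => spanningSets μ n ×ˢ spanningSets ν n with hR
    have hRm : ∀ n, MeasurableSet (R n) := fun n =>
      (measurableSet_spanningSets μ n).prod (measurableSet_spanningSets ν n)
    have hRmono : Monotone R := fun n m hnm =>
      Set.prod_mono (monotone_spanningSets μ hnm) (monotone_spanningSets ν hnm)
    have hRU : s ⊆ ⋃ n, R n := by
      rw [hR, iUnion_prod_of_monotone (monotone_spanningSets μ) (monotone_spanningSets ν) (iUnion_spanningSets μ)
        (iUnion_spanningSets ν)]
      exact Set.subset_univ _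
    have htend := tendsto_indicatorConstLp_inter_of_monotone (μ.prod ν) hs hρs R hRm hRmono hRU
    have hstep : ∀ n, ⟪F, indicatorConstLp 2 (hs.inter (hRm n))
        ((measure_mono Set.inter_subset_left).trans_lt hρs.lt_top).ne (1 : ℂ)⟫_ℂ = 0 := fun n =>
      inner_indicatorConstLp_inter_eq_zero_of_rectangles μ ν F hrect (measurableSet_spanningSets μ n)
        (measurableSet_spanningSets ν n) (measure_spanningSets_lt_top μ n).ne (measure_spanningSets_lt_top ν n).ne
        s hs _
    have hlim := ((tendsto_const_nhds (x := F)).inner htend).congr hstep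
    exact tendsto_nhds_unique hlim tendsto_const_nhds
  -- (3) orthogonal to everything (density of simple functions), in particular to itself
  have hall : ∀ G : Lp ℂ 2 (μ.prod ν), ⟪F, G⟫_ℂ = 0 := by
    refine Lp.induction (μ := μ.prod ν) ENNReal.ofNat_ne_top (motive := fun G => ⟪F, G⟫_ℂ = 0) ?_ ?_ ?_
    · intro c s hs hρs
      rw [Lp.simpleFunc.coe_indicatorConst, indicatorConstLp_eq_smul_one (μ.prod ν) hs hρs.ne c, inner_smul_right,
        hind s hs hρs.ne, mul_zero]
    · intro f g hf hg _ hf0 hg0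
      rw [inner_add_right, hf0, hg0, add_zero]
    · exact isClosed_eq (continuous_const.inner continuous_id) continuous_const
  exact inner_self_eq_zero.1 (hall F)

/-- **tensor products of total families are total**: for σ-finite `μ`, `ν` and families `a i ∈ L²(μ)`,
`b k ∈ L²(ν)` whose spans are dense, the tensors `a i ⊗ b k` span a dense subspace of `L²(μ ⊗ ν)` — the density
half of `L²(μ) ⊗̂ L²(ν) = L²(μ ⊗ ν)`. [cite: ReedSimonI1980, §II.4 Theorem II.10] -/
theorem dense_span_tensor {ι κ : Type*} (a : ι → Lp ℂ 2 μ) (b : κ → Lp ℂ 2 ν)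
    (ha : Dense (Submodule.span ℂ (Set.range a) : Set (Lp ℂ 2 μ)))
    (hb : Dense (Submodule.span ℂ (Set.range b) : Set (Lp ℂ 2 ν))) :
    Dense (Submodule.span ℂ (Set.range fun p : ι × κ => (memLp_tensor_Lp μ ν (a p.1) (b p.2)).toLp _) :
      Set (Lp ℂ 2 (μ.prod ν))) := by
  rw [Submodule.dense_iff_topologicalClosure_eq_top, Submodule.topologicalClosure_eq_top_iff, Submodule.eq_bot_iff]
  intro F hF
  rw [Submodule.mem_orthogonal'] at hF
  exact eq_zero_of_inner_tensor_eq_zero μ ν a b ha hb F fun i k => hF _ (Submodule.subset_span ⟨(i, k), rfl⟩)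

end Literature.MeasureTheory.Integral

end

/-! ## Appendix: subtraction in either factor -/

namespace Literature.MeasureTheory.Integral

open _root_.MeasureTheory

variable {X Y : Type*} [MeasurableSpace X] [MeasurableSpace Y] (μ : Measure X) (ν : Measure Y) [SigmaFinite ν]

/-- subtraction in the first factor (as `L²` classes): `(f - f') ⊗ g = f ⊗ g - f' ⊗ g`.
[cite: ReedSimonI1980, §II.4 Theorem II.10] -/
theorem toLp_tensor_sub_left (f f' : Lp ℂ 2 μ) (g : Lp ℂ 2 ν) :
    (memLp_tensor_Lp μ ν (f - f') g).toLp _ =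
      (memLp_tensor_Lp μ ν f g).toLp _ - (memLp_tensor_Lp μ ν f' g).toLp _ := by
  rw [sub_eq_add_neg, toLp_tensor_add_left, ← neg_one_smul ℂ f', toLp_tensor_smul_left, neg_one_smul,
    sub_eq_add_neg]

/-- subtraction in the second factor (as `L²` classes): `f ⊗ (g - g') = f ⊗ g - f ⊗ g'`.
[cite: ReedSimonI1980, §II.4 Theorem II.10] -/
theorem toLp_tensor_sub_right (f : Lp ℂ 2 μ) (g g' : Lp ℂ 2 ν) :
    (memLp_tensor_Lp μ ν f (g - g')).toLp _ =
      (memLp_tensor_Lp μ ν f g).toLp _ - (memLp_tensor_Lp μ ν f g').toLp _ := by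
  rw [sub_eq_add_neg, toLp_tensor_add_right, ← neg_one_smul ℂ g', toLp_tensor_smul_right, neg_one_smul,
    sub_eq_add_neg]

end Literature.MeasureTheory.Integral
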